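/-
Copyright (c) 2026 the pub-hodgecm-mathlib formalisation cell (harness21).  Prover seat hodgecm-mathlib-K2E3-p14 (g2), Track B «K2-LIT» ∕ h413
(`stmt-HodgeConjecture-24833`), unit U12 «Harish-Chandra characters» of the line `K2_E3_EllipticInputs`, socket U12-h ‹#9L› `sig_K2E3CharLocConstNearRegular`:
brick (Fr) «the congruence frame» of the 9L line lead's depth-halving road (K2E3-p09 (g2), MEMO v4 `K2/K2E3-p09/g2/MEMO-U12h-HF-bricks.v4`, §2), part 2 of 2
(transport along the one-place model, the slice set, the CM frame); taken as a free hand on the K2 bus 2026-09-03T23:27Z.  2026-09-03.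
-/
import Summits.HodgeConjecture.HodgeConjecture.Theorems.K2E3SubgroupCongruenceLevels         -- ★ part 1 (this seat): levels `U ∩ K_γ` of a subgroup `U ≤ GL_n(F)` (open, compact, normalised, basis) and heights; brings ★ `GLnCongruenceSubgroups`, ★ `CongruenceSubgroupExpansionGL`, ★ p855559
import Literature.NumberTheory.Automorphic.UnitaryGroupIntegralPointsReduction                -- ★ `isOpen_subgroupOf_unitaryGroupOfForm`, `isCompact_subgroupOf_unitaryGroupOfForm` (closed embedding `U(σ, J) ↪ GL_n`); brings ★ `isClosed_unitaryGroupOfForm`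
import Literature.NumberTheory.Automorphic.LocalUnitaryGroupCongr                             -- ★ the one-place model `localNonsplitEquiv : U(H)(L⁺_v) ≃ₜ* U(σ_w, H_w)(L_w)` at a non-split `v`
import Literature.NumberTheory.Automorphic.AdicCompletionLocalField                           -- ★ instances: `L_w` is a non-archimedean local field (`ValuativeRel`, `IsNonarchimedeanLocalField`)
import Literature.NumberTheory.Automorphic.GaloisActionPlaces                                 -- ★ `continuous_galAdicCompletionMap` (`σ_w` continuous ⇒ `U(σ_w, H_w)` closed)
import HarnessLib

/-!
# Crux `H413` — K2-LIT E3 «EllipticInputs», U12-h brick (Fr), part 2: THE CONGRUENCE FRAME OF `U_N(H)(L⁺_v)` — levels pulled back along a topological-group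
# isomorphism `e : G ≃ₜ* U ≤ GL_n(F)` (the one-place model): compact open subgroups, nested, NORMALISED BY THE INTEGRAL LEVEL (`∀ x ∈ K₁, K₀.map (conj x) = K₀` in the
# consumer's bytes), a neighbourhood basis of `1`, every open subgroup contains a deep one, heights of `e`-images bounded on compact sets; the slice set
# `𝒰 = (K₁ · S · K₁⁻¹) · K₀` is open and contains `γ K₀`; compact centraliser slices exist; the CM dress at a non-split place

Cell `hodgecm-mathlib`, Track B «K2-LIT», crux item `stmt-HodgeConjecture-24833` (h413), line `K2_E3_EllipticInputs`, unit U12 «HC characters», socket U12-h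
`sig_K2E3CharLocConstNearRegular` (‹#9L›, `Cruxes/H413/Lines/K2_E3_EllipticInputsSigs_U12Characters.lean` ED. 3 :77).  Brick (Fr) `K2E3UnitaryCongruenceFrame` of the 9L
line lead's brick table (K2E3-p09 (g2) MEMO v4 §2: «`K_m ⊴ K_0` compact open in `(cmDatum L N H).Local v` (all `w ∣ v`), basis of nbhds of `1`, `h(γ t k₀)` bounded on
`γT₁K₀`, `𝒰 = (γT₁)^{K₁}K₀` open `⊇ γK₀`»), free-hand deal — PART 2; part 1 is ★ `K2E3SubgroupCongruenceLevels` (levels inside `GL_n(F)`, heights).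
`--supports stmt-HodgeConjecture-24833 --as helper`.  THEOREMS ONLY — no `def`, no named fact, no instance, no notation, no `sorry`.  HONEST LABEL: HC_CM is proved only
modulo the 7 printed citations (2 remaining named inputs: hLiu418 = stmt-HodgeConjecture-24832, h413 = stmt-HodgeConjecture-24833) until rung 0 closes; this file is
count-neutral topological-group plumbing (it pays no letter by itself).

WHERE IT SITS.  The ★ chain #9 ⟸ 13a ∧ 9L [p855030] ⟸ 9L_adm [p855081] ⟸ STAB [p855210] ⟸ TVAN [p855569] ⟸ HF [p855602] is GENERIC in a topological group `G` with
compact open subgroups `K₀ ≤ K₁`, `K₀` normalised by `K₁` (binder `∀ x ∈ K₁, K₀.map (MulAut.conj x).toMonoidHom = K₀`), and an open `𝒰` with `∀ x ∈ K₀, γ * x ∈ 𝒰`.  At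
the frame `G = (cmDatum L N H).Local v` (non-split `v`, one place `w ∣ v`) the one-place model ★ `localNonsplitEquiv` is a topological-group isomorphism `e : G ≃ₜ* U_w` onto
the closed `U_w = U(σ_w, H_w)(L_w) ≤ GL_N(L_w)`; the frame's subgroups are `K_γ := e⁻¹(U_w ∩ congruenceGL N γ) = (congruenceGL N γ).comap (U_w.subtype.comp e)` — so ALL of
★ `GLnCongruenceCommutators` §4 (commutators `⁅K_γ, K_γ'⁆ ≤ K_{γγ'}`, normality along any `f : G →* GL_n`) applies to them verbatim — `K₁ = K_{|ϖ|^ν}`, `K₀ = K_{|ϖ|^{N₀}}`,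
`T₁ = Z(γ) ⊓ K_m` (a compact torus level with `γT₁` inside any prescribed neighbourhood of `γ`, e.g. the regular set), and `𝒰 = (K₁ · γT₁ · K₁⁻¹) · K₀` (open since `K₀`
is; ★ L1 p855243 makes it a neighbourhood of `γ`); the line lead's «`h` bounded» clause (K2 bus 2026-09-03T23:30:48Z) is the UNIFORM HEIGHT of `e y`, `y ∈ 𝒰`.
* §3 TRANSPORT ALONG `e : G ≃ₜ* U` (any `U ≤ GL_n(F)`, closed where compactness is claimed): the pulled-back levels inherit open ∕ compact ∕ monotone ∕ normalised (element and
  `∀ x ∈ K₁` forms) ∕ neighbourhood basis ∕ «open subgroups contain a deep level» from ★ part 1; `⁅K_m, K_{m'}⁆ ≤ K_{m+m'}`; heights of `e`-images are bounded on compact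
  subsets of `G`; membership is `g ∈ K_γ ↔ (e g : GL_n(F)) ∈ congruenceGL n γ` (`Iff.rfl`).
* §4 THE SLICE SET (any topological group): `𝒰 := ((p ↦ p.1 p.2 p.1⁻¹) '' (K₁ ×ˢ S)) · K₀` is open for `K₀` an open subgroup, contains `γ x` (`γ ∈ S`, `1 ∈ K₁`, `x ∈ K₀`:
  the consumer's `∀ x ∈ K₀, γ * x ∈ 𝒰`), each `y ∈ 𝒰` reads `k s k⁻¹ k₀` (and `k (γ t) k⁻¹ k₀` when `S = γT₁`), `𝒰 ∈ 𝓝 γ` once `K₁ S K₁⁻¹ ∈ 𝓝 γ`; centralisers are closed,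
  compact centraliser slices exist in locally compact Hausdorff groups; WITH `e`: the torus level `Z(γ) ⊓ K_m` is compact, `γ · (Z(γ) ⊓ K_m) ⊆ W` for `m` large, and the
  HEIGHT OF `e y` IS UNIFORMLY BOUNDED ON `𝒰` when `S` is compact and `K₁, K₀` are integral.
* §5 THE CM FRAME (non-split `v`, `c • w = w`): `U_w` closed; the CM levels are compact open, a neighbourhood basis of `1`, normalised by the CM integral level
  `e⁻¹(U_w ∩ GL_N(𝒪_w))` in the consumer's bytes; membership is read on the `w`-evaluated matrix of `g ∈ GL_N(L ⊗ L⁺_v)` (`rfl`, the ★ `coe_localNonsplitEquiv_apply` pattern).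

## References
* [BernsteinZelevinsky1976] I. N. Bernstein, A. V. Zelevinsky, *Representations of the group GL(n,F) where F is a non-archimedean local field*, Russian Math. Surveys 31:3
  (1976), §1.1 (congruence subgroups are a basis of neighbourhoods of `1`), §3.
* [Casselman1995] W. Casselman, *Introduction to the theory of admissible representations of p-adic reductive groups* (draft 1995), §1.4 Prop. 1.4.4.
* [HarishChandra1999] Harish-Chandra (notes by S. DeBacker and P. J. Sally, Jr.), *Admissible Invariant Distributions on Reductive p-adic Groups*, ULECT 16, AMS (1999): §18
  p. 79 (the submersion `(x, m) ↦ x γ m x⁻¹`), §19 Lemmas 19.2–19.4, Cor. 19.5, pp. 84–86 (the torus slice `γT₁`, conjugation by elements of bounded height).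
* [PlatonovRapinchuk1994] V. Platonov, A. Rapinchuk, *Algebraic Groups and Number Theory* (1994), §3.3 (congruence subgroups of `G(𝒪_v)`), §5.1 (the one-place model).
-/

set_option autoImplicit false
-- the mandated namespace repeats `HodgeConjecture.HodgeConjecture`, as in every `Theorems/*.lean` of this sub-problem
set_option linter.dupNamespace false

noncomputable section

open Topology Filter Set ValuativeRel Matrix
open NumberField IsDedekindDomain
open Literature.NumberTheory.Automorphic Literature.NumberTheory.Automorphic.UnitaryGroup Literature.NumberTheory.GaloisRepresentations
open Summit.HodgeConjecture.HodgeConjecture.Cruxes.H413 Summit.HodgeConjecture.HodgeConjecture.Cruxes.H413.K2E3SubgroupCongruenceLevels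
open scoped MatrixGroups Pointwise

namespace Summit.HodgeConjecture.HodgeConjecture.Cruxes.H413.K2E3UnitaryCongruenceFrame

/-! ## §3 Transport along a topological-group isomorphism `e : G ≃ₜ* U` (the one-place model) -/

section Transport

variable {F : Type*} [Field F] [ValuativeRel F] [TopologicalSpace F] {n : ℕ} {U : Subgroup (GL (Fin n) F)}
  {G : Type*} [Group G] [TopologicalSpace G] (e : G ≃ₜ* U)

omit [ValuativeRel F] in
/-- The transport hom `G → U ≤ GL_n(F)` on elements: `g ↦` the matrix unit of `e g` (definitional). [cite: PlatonovRapinchuk1994, §5.1] -/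
theorem subtype_comp_apply (g : G) : (U.subtype.comp e.toMulEquiv.toMonoidHom) g = ((e g : U) : GL (Fin n) F) :=
  rfl

/-- Membership in the pulled-back level `e⁻¹(U ∩ K_γ)` is membership of the matrix of `e g` in `K_γ` (definitional). [cite: PlatonovRapinchuk1994, §5.1] -/
theorem mem_comap_congruenceGL_iff (γ : ValueGroupWithZero F) (g : G) :
    g ∈ (congruenceGL n γ).comap (U.subtype.comp e.toMulEquiv.toMonoidHom) ↔ ((e g : U) : GL (Fin n) F) ∈ congruenceGL n γ :=
  Iff.rfl

/-- The pulled-back level is the `e`-preimage of `U ∩ K_γ` (as subgroups of `G`). [cite: PlatonovRapinchuk1994, §5.1] -/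
theorem comap_congruenceGL_eq_comap_subgroupOf (γ : ValueGroupWithZero F) :
    (congruenceGL n γ).comap (U.subtype.comp e.toMulEquiv.toMonoidHom) = ((congruenceGL n γ).subgroupOf U).comap e.toMulEquiv.toMonoidHom := by
  rw [Subgroup.subgroupOf, Subgroup.comap_comap]

/-- … and as SETS: `e ⁻¹' (U ∩ K_γ)`. [cite: PlatonovRapinchuk1994, §5.1] -/
theorem coe_comap_congruenceGL_eq_preimage (γ : ValueGroupWithZero F) :
    ((congruenceGL n γ).comap (U.subtype.comp e.toMulEquiv.toMonoidHom) : Set G) = e ⁻¹' (((congruenceGL n γ).subgroupOf U : Subgroup U) : Set U) :=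
  rfl

/-- The pulled-back levels are MONOTONE in `γ`. [cite: BernsteinZelevinsky1976, §3] -/
theorem comap_congruenceGL_mono {γ δ : ValueGroupWithZero F} (h : γ ≤ δ) :
    (congruenceGL n γ).comap (U.subtype.comp e.toMulEquiv.toMonoidHom) ≤ (congruenceGL n δ).comap (U.subtype.comp e.toMulEquiv.toMonoidHom) :=
  Subgroup.comap_mono (congruenceGL_mono h)

variable {ϖ : F} in
/-- `|ϖ|`-indexing: `e⁻¹(U ∩ K_{m'}) ≤ e⁻¹(U ∩ K_m)` for `m ≤ m'`. [cite: HarishChandra1999, §17 p. 80] -/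
theorem comap_congruenceGL_pow_le_of_le (hϖ : IsUniformizingElement ϖ) {m m' : ℕ} (h : m ≤ m') :
    (congruenceGL n (valuation F ϖ ^ m')).comap (U.subtype.comp e.toMulEquiv.toMonoidHom) ≤
      (congruenceGL n (valuation F ϖ ^ m)).comap (U.subtype.comp e.toMulEquiv.toMonoidHom) := by
  obtain ⟨d, rfl⟩ := Nat.exists_eq_add_of_le h
  exact Subgroup.comap_mono (K2E3CongruenceLayerIntertwiningGL.congruenceGL_pow_add_le hϖ m d)

/-- **COMMUTATORS OF LEVELS: `⁅K_m, K_{m'}⁆ ≤ K_{m+m'}`** for the pulled-back levels (★ `commutator_comap_congruenceGL_le` along `f = U.subtype.comp e`, `|ϖ|^m |ϖ|^{m'} = |ϖ|^{m+m'}`;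
for a general pair of levels use ★ `commutator_comap_congruenceGL_le` ∕ `conj_mem_comap_congruenceGL` directly). [cite: Casselman1995, §1.4 Prop. 1.4.4] [cite: BernsteinZelevinsky1976, §3] -/
theorem commutator_comap_congruenceGL_pow_le (ϖ : F) (m m' : ℕ) :
    ⁅(congruenceGL n (valuation F ϖ ^ m)).comap (U.subtype.comp e.toMulEquiv.toMonoidHom),
      (congruenceGL n (valuation F ϖ ^ m')).comap (U.subtype.comp e.toMulEquiv.toMonoidHom)⁆ ≤
      (congruenceGL n (valuation F ϖ ^ (m + m'))).comap (U.subtype.comp e.toMulEquiv.toMonoidHom) := by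
  rw [pow_add]
  exact commutator_comap_congruenceGL_le _ _ _

/-- **THE PULLED-BACK LEVELS ARE NORMALISED BY THE INTEGRAL ELEMENTS OF `G`** (consumer's bytes): for `x : G` with `e x ∈ GL_n(𝒪)`,
`(e⁻¹(U ∩ K_γ)).map (MulAut.conj x).toMonoidHom = e⁻¹(U ∩ K_γ)`. [cite: BernsteinZelevinsky1976, §3] [cite: Casselman1995, §1.4 Prop. 1.4.4] -/
theorem map_conj_comap_congruenceGL {x : G} (hx : ((e x : U) : GL (Fin n) F) ∈ glInt n F) (γ : ValueGroupWithZero F) :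
    ((congruenceGL n γ).comap (U.subtype.comp e.toMulEquiv.toMonoidHom)).map (MulAut.conj x).toMonoidHom =
      (congruenceGL n γ).comap (U.subtype.comp e.toMulEquiv.toMonoidHom) := by
  apply le_antisymm
  · rintro _ ⟨k, hk, rfl⟩
    have hk' : ((e k : U) : GL (Fin n) F) ∈ congruenceGL n γ := hk
    show ((e (x * k * x⁻¹) : U) : GL (Fin n) F) ∈ congruenceGL n γ
    rw [map_mul, map_mul, map_inv, Subgroup.coe_mul, Subgroup.coe_mul, Subgroup.coe_inv]
    exact conj_mem_congruenceGL hx hk'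
  · intro k hk
    have hk' : ((e k : U) : GL (Fin n) F) ∈ congruenceGL n γ := hk
    refine ⟨x⁻¹ * k * x, ?_, ?_⟩
    · have h := conj_mem_congruenceGL (Subgroup.inv_mem _ hx) hk'
      rw [inv_inv] at h
      show ((e (x⁻¹ * k * x) : U) : GL (Fin n) F) ∈ congruenceGL n γ
      rw [map_mul, map_mul, map_inv, Subgroup.coe_mul, Subgroup.coe_mul, Subgroup.coe_inv]
      exact h
    · show x * (x⁻¹ * k * x) * x⁻¹ = k
      group

/-- … hence BY EVERY ELEMENT OF EVERY PULLED-BACK LEVEL: `∀ x ∈ e⁻¹(U ∩ K_δ), (e⁻¹(U ∩ K_γ)).map (conj x) = e⁻¹(U ∩ K_γ)` — the `hnK₀`∕`hnK'` binders of ★ p855602 at the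
frame with `K₁ = e⁻¹(U ∩ K_δ)`. [cite: BernsteinZelevinsky1976, §3] -/
theorem forall_map_conj_comap_congruenceGL_of_mem (δ γ : ValueGroupWithZero F) :
    ∀ x ∈ (congruenceGL n δ).comap (U.subtype.comp e.toMulEquiv.toMonoidHom),
      ((congruenceGL n γ).comap (U.subtype.comp e.toMulEquiv.toMonoidHom)).map (MulAut.conj x).toMonoidHom =
        (congruenceGL n γ).comap (U.subtype.comp e.toMulEquiv.toMonoidHom) :=
  fun _ hx => map_conj_comap_congruenceGL e (congruenceGL_le_glInt δ hx) γ

/-- The same with `K₁ = e⁻¹(U ∩ GL_n(𝒪))`, the integral level of `G`. [cite: BernsteinZelevinsky1976, §3] -/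
theorem forall_map_conj_comap_congruenceGL_of_mem_glInt (γ : ValueGroupWithZero F) :
    ∀ x ∈ (glInt n F).comap (U.subtype.comp e.toMulEquiv.toMonoidHom),
      ((congruenceGL n γ).comap (U.subtype.comp e.toMulEquiv.toMonoidHom)).map (MulAut.conj x).toMonoidHom =
        (congruenceGL n γ).comap (U.subtype.comp e.toMulEquiv.toMonoidHom) :=
  fun _ hx => map_conj_comap_congruenceGL e hx γ

end Transport

section TransportTopology

variable {F : Type*} [Field F] [ValuativeRel F] [TopologicalSpace F] [IsNonarchimedeanLocalField F] {n : ℕ} {U : Subgroup (GL (Fin n) F)}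
  {G : Type*} [Group G] [TopologicalSpace G] (e : G ≃ₜ* U)

/-- **`e⁻¹(U ∩ K_γ)` IS OPEN in `G`** (`γ ≠ 0`). [cite: BernsteinZelevinsky1976, §1.1] -/
theorem isOpen_comap_congruenceGL {γ : ValueGroupWithZero F} (hγ : γ ≠ 0) :
    IsOpen (((congruenceGL n γ).comap (U.subtype.comp e.toMulEquiv.toMonoidHom) : Subgroup G) : Set G) := by
  rw [coe_comap_congruenceGL_eq_preimage]
  exact (isOpen_congruenceGL_subgroupOf U hγ).preimage (map_continuous e)

/-- **`e⁻¹(U ∩ K_γ)` IS COMPACT in `G`** when `U` is closed in `GL_n(F)` (`e` is a homeomorphism). [cite: PlatonovRapinchuk1994, §3.3, §5.1] -/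
theorem isCompact_comap_congruenceGL (hU : IsClosed (U : Set (GL (Fin n) F))) (γ : ValueGroupWithZero F) :
    IsCompact (((congruenceGL n γ).comap (U.subtype.comp e.toMulEquiv.toMonoidHom) : Subgroup G) : Set G) := by
  rw [coe_comap_congruenceGL_eq_preimage]
  exact (HomeomorphClass.toHomeomorph e).isClosedEmbedding.isCompact_preimage (isCompact_congruenceGL_subgroupOf U hU γ)

/-- **THE PULLED-BACK LEVELS ARE A NEIGHBOURHOOD BASIS OF `1` IN `G`**: every `O ∈ 𝓝 (1 : G)` contains `e⁻¹(U ∩ K_γ)` for some unit `γ`. [cite: BernsteinZelevinsky1976, §1.1] -/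
theorem exists_comap_congruenceGL_subset {O : Set G} (hO : O ∈ 𝓝 (1 : G)) :
    ∃ γ : (ValueGroupWithZero F)ˣ, (((congruenceGL n (γ : ValueGroupWithZero F)).comap (U.subtype.comp e.toMulEquiv.toMonoidHom) : Subgroup G) : Set G) ⊆ O := by
  have hO' : e.symm ⁻¹' O ∈ 𝓝 (1 : U) := by
    refine (map_continuous e.symm).continuousAt.preimage_mem_nhds ?_
    rwa [map_one]
  obtain ⟨γ, hγ⟩ := exists_congruenceGL_subgroupOf_subset U hO'
  refine ⟨γ, fun g hg => ?_⟩
  have h := hγ (show e g ∈ (((congruenceGL n (γ : ValueGroupWithZero F)).subgroupOf U : Subgroup U) : Set U) from hg)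
  rwa [Set.mem_preimage, ContinuousMulEquiv.symm_apply_apply] at h

variable {ϖ : F}

/-- The same in the `|ϖ|^m` indexing. [cite: BernsteinZelevinsky1976, §1.1] -/
theorem exists_comap_congruenceGL_pow_subset (hϖ0 : ϖ ≠ 0) (hϖ1 : valuation F ϖ < 1) {O : Set G} (hO : O ∈ 𝓝 (1 : G)) :
    ∃ m : ℕ, (((congruenceGL n (valuation F ϖ ^ m)).comap (U.subtype.comp e.toMulEquiv.toMonoidHom) : Subgroup G) : Set G) ⊆ O := by
  obtain ⟨γ, hγ⟩ := exists_comap_congruenceGL_subset e hO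
  obtain ⟨m, hm⟩ := exists_pow_mul_le ((Valuation.ne_zero_iff _).2 hϖ0) hϖ1 (1 : ValueGroupWithZero F) (Units.ne_zero γ)
  rw [mul_one] at hm
  exact ⟨m, fun k hk => hγ (comap_congruenceGL_mono e hm hk)⟩

/-- **EVERY OPEN SUBGROUP `K′ ≤ G` CONTAINS A DEEP PULLED-BACK LEVEL `e⁻¹(U ∩ K_m)`**. [cite: BernsteinZelevinsky1976, §1.1] -/
theorem exists_comap_congruenceGL_pow_le (hϖ0 : ϖ ≠ 0) (hϖ1 : valuation F ϖ < 1) {K' : Subgroup G} (hK' : IsOpen (K' : Set G)) :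
    ∃ m : ℕ, (congruenceGL n (valuation F ϖ ^ m)).comap (U.subtype.comp e.toMulEquiv.toMonoidHom) ≤ K' := by
  obtain ⟨m, hm⟩ := exists_comap_congruenceGL_pow_subset e hϖ0 hϖ1 (hK'.mem_nhds (Subgroup.one_mem K'))
  exact ⟨m, fun k hk => hm hk⟩

/-- **HEIGHTS OF `e`-IMAGES ARE BOUNDED ON COMPACT SUBSETS OF `G`** (e.g. on the compact torus slice `S = Z(γ) ∩ O` of §4): `∃ h, ∀ s ∈ S`, the matrix of `e s` and its inverse
have entries `≤ (|ϖ|^h)⁻¹`. [cite: HarishChandra1999, §19 pp. 84–86] -/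
theorem exists_height_of_isCompact_transport (hϖ0 : ϖ ≠ 0) (hϖ1 : valuation F ϖ < 1) {S : Set G} (hS : IsCompact S) :
    ∃ h : ℕ, ∀ s ∈ S, ValBound (valuation F ϖ ^ h)⁻¹ (((e s : U) : GL (Fin n) F) : Matrix (Fin n) (Fin n) F) ∧
      ValBound (valuation F ϖ ^ h)⁻¹ ((((e s : U) : GL (Fin n) F)⁻¹ : GL (Fin n) F) : Matrix (Fin n) (Fin n) F) := by
  obtain ⟨h, hh⟩ := exists_height_of_isCompact_subgroup hϖ0 hϖ1 U (hS.image (map_continuous e))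
  exact ⟨h, fun s hs => hh _ (Set.mem_image_of_mem _ hs)⟩

end TransportTopology

/-! ## §4 The slice set `𝒰 = (K₁ · S · K₁⁻¹) · K₀` and compact centraliser slices (any topological group) -/

section Slice

variable {G : Type*} [Group G]

/-- `γ x ∈ 𝒰` for `γ ∈ S`, `1 ∈ K₁`, `x ∈ K₀` — the consumer's binder `∀ x ∈ K₀, γ * x ∈ 𝒰` of ★ p855602 `exists_nhds_levelTraceStable_of_howeFiniteness`.
[cite: HarishChandra1999, §19 p. 84] -/
theorem forall_mul_mem_conjSlice_mul {K₁ S : Set G} (h1 : (1 : G) ∈ K₁) {γ : G} (hγ : γ ∈ S) (K₀ : Subgroup G) :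
    ∀ x ∈ K₀, γ * x ∈ (fun p : G × G => p.1 * p.2 * p.1⁻¹) '' (K₁ ×ˢ S) * (K₀ : Set G) := fun x hx =>
  Set.mul_mem_mul ⟨(1, γ), Set.mk_mem_prod h1 hγ, by simp⟩ hx

/-- Every point of `𝒰` is `k s k⁻¹ k₀` with `k ∈ K₁`, `s ∈ S`, `k₀ ∈ K₀`. [cite: HarishChandra1999, §19 p. 84] -/
theorem exists_eq_conj_mul_of_mem_conjSlice_mul {K₁ S : Set G} {K₀ : Subgroup G} {y : G}
    (hy : y ∈ (fun p : G × G => p.1 * p.2 * p.1⁻¹) '' (K₁ ×ˢ S) * (K₀ : Set G)) :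
    ∃ k ∈ K₁, ∃ s ∈ S, ∃ k₀ ∈ K₀, y = k * s * k⁻¹ * k₀ := by
  obtain ⟨a, ⟨p, hp, rfl⟩, k₀, hk₀, rfl⟩ := Set.mem_mul.1 hy
  exact ⟨p.1, (Set.mem_prod.1 hp).1, p.2, (Set.mem_prod.1 hp).2, k₀, hk₀, rfl⟩

/-- The reader for a TRANSLATED TORUS LEVEL `S = γT₁`: every `y ∈ 𝒰` is `k (γ t) k⁻¹ k₀` with `k ∈ K₁`, `t ∈ T₁`, `k₀ ∈ K₀` (line lead's shape, K2 bus 23:30:48Z).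
[cite: HarishChandra1999, §19 p. 84] -/
theorem exists_eq_conj_mul_mul_of_mem_conjSlice_mul {K₁ T₁ : Set G} {K₀ : Subgroup G} {γ y : G}
    (hy : y ∈ (fun p : G × G => p.1 * p.2 * p.1⁻¹) '' (K₁ ×ˢ ((fun t : G => γ * t) '' T₁)) * (K₀ : Set G)) :
    ∃ k ∈ K₁, ∃ t ∈ T₁, ∃ k₀ ∈ K₀, y = k * (γ * t) * k⁻¹ * k₀ := by
  obtain ⟨k, hk, s, ⟨t, ht, rfl⟩, k₀, hk₀, rfl⟩ := exists_eq_conj_mul_of_mem_conjSlice_mul hy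
  exact ⟨k, hk, t, ht, k₀, hk₀, rfl⟩

/-- `γ x ∈ 𝒰` for `x ∈ K₀` when `S = γT₁` with `1 ∈ T₁`, `1 ∈ K₁` — the `hγ` binder of ★ p855602 for the torus-level slice. [cite: HarishChandra1999, §19 p. 84] -/
theorem forall_mul_mem_conjSlice_mul_of_one_mem {K₁ T₁ : Set G} (h1 : (1 : G) ∈ K₁) (h1' : (1 : G) ∈ T₁) (γ : G) (K₀ : Subgroup G) :
    ∀ x ∈ K₀, γ * x ∈ (fun p : G × G => p.1 * p.2 * p.1⁻¹) '' (K₁ ×ˢ ((fun t : G => γ * t) '' T₁)) * (K₀ : Set G) :=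
  forall_mul_mem_conjSlice_mul h1 (show γ ∈ (fun t : G => γ * t) '' T₁ from ⟨1, h1', mul_one γ⟩) K₀

/-- Conversely `k s k⁻¹ k₀ ∈ 𝒰`. [cite: HarishChandra1999, §19 p. 84] -/
theorem conj_mul_mem_conjSlice_mul {K₁ S : Set G} {K₀ : Subgroup G} {k s k₀ : G} (hk : k ∈ K₁) (hs : s ∈ S) (hk₀ : k₀ ∈ K₀) :
    k * s * k⁻¹ * k₀ ∈ (fun p : G × G => p.1 * p.2 * p.1⁻¹) '' (K₁ ×ˢ S) * (K₀ : Set G) :=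
  Set.mul_mem_mul ⟨(k, s), Set.mk_mem_prod hk hs, rfl⟩ hk₀

variable [TopologicalSpace G]

/-- **`𝒰 := {k s k⁻¹ : k ∈ K₁, s ∈ S} · K₀` IS OPEN** whenever `K₀` is an open subgroup (a union of right cosets of `K₀`; no hypothesis on `K₁`, `S`).
[cite: HarishChandra1999, §19 p. 84] -/
theorem isOpen_conjSlice_mul [ContinuousConstSMul G G] (K₁ S : Set G) {K₀ : Subgroup G} (hK₀ : IsOpen (K₀ : Set G)) :
    IsOpen ((fun p : G × G => p.1 * p.2 * p.1⁻¹) '' (K₁ ×ˢ S) * (K₀ : Set G)) :=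
  hK₀.mul_left

/-- `𝒰 ⊇ {k s k⁻¹} ⊇` any set it is shown to contain: if `K₁ S K₁⁻¹ ∈ 𝓝 γ` (★ L1 p855243 at a regular `γ`) then `𝒰 ∈ 𝓝 γ`. [cite: HarishChandra1999, §18 p. 79, §19 p. 84] -/
theorem conjSlice_mul_mem_nhds {K₁ S : Set G} {K₀ : Subgroup G} {γ : G}
    (h : (fun p : G × G => p.1 * p.2 * p.1⁻¹) '' (K₁ ×ˢ S) ∈ 𝓝 γ) :
    (fun p : G × G => p.1 * p.2 * p.1⁻¹) '' (K₁ ×ˢ S) * (K₀ : Set G) ∈ 𝓝 γ :=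
  Filter.mem_of_superset h fun y hy => by simpa using Set.mul_mem_mul hy (Subgroup.one_mem K₀)

/-- The centraliser of a point is CLOSED in a Hausdorff topological group. [cite: HarishChandra1999, §19 p. 84] -/
theorem isClosed_centralizer_singleton [IsTopologicalGroup G] [T2Space G] (γ : G) :
    IsClosed ((Subgroup.centralizer ({γ} : Set G) : Subgroup G) : Set G) := by
  have hset : ((Subgroup.centralizer ({γ} : Set G) : Subgroup G) : Set G) = {x : G | γ * x = x * γ} := by
    ext x
    simp [Subgroup.mem_centralizer_iff]
  rw [hset]
  exact isClosed_eq (continuous_const.mul continuous_id) (continuous_id.mul continuous_const)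

/-- **COMPACT CENTRALISER SLICES** (the torus slice `S = γT₁` of HC1999 §19): in a locally compact Hausdorff group, every `W ∈ 𝓝 γ` contains a neighbourhood `O` of `γ` with
`Z(γ) ∩ O` compact and containing `γ`. [cite: HarishChandra1999, §19 p. 84] -/
theorem exists_compact_centralizer_slice [IsTopologicalGroup G] [T2Space G] [LocallyCompactSpace G] (γ : G) {W : Set G} (hW : W ∈ 𝓝 γ) :
    ∃ O ∈ 𝓝 γ, O ⊆ W ∧ IsCompact (((Subgroup.centralizer ({γ} : Set G) : Subgroup G) : Set G) ∩ O) ∧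
      γ ∈ ((Subgroup.centralizer ({γ} : Set G) : Subgroup G) : Set G) ∩ O := by
  obtain ⟨O, hO, hOW, hOc⟩ := local_compact_nhds hW
  exact ⟨O, hO, hOW, hOc.inter_left (isClosed_centralizer_singleton γ),
    ⟨by simp [Subgroup.mem_centralizer_iff], mem_of_mem_nhds hO⟩⟩

end Slice

/-! ## §4 (with `e`) Compact torus levels `Z(γ) ⊓ K_m` near `γ`, and the uniform height on `𝒰` -/

section SliceTransport

variable {F : Type*} [Field F] [ValuativeRel F] [TopologicalSpace F] [IsNonarchimedeanLocalField F] {n : ℕ} {U : Subgroup (GL (Fin n) F)}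
  {G : Type*} [Group G] [TopologicalSpace G] [IsTopologicalGroup G] (e : G ≃ₜ* U) {ϖ : F}

/-- **THE TORUS LEVEL `T₁ = Z(γ) ⊓ K_m` IS COMPACT** (`U` closed, `G` Hausdorff: centralisers are closed, levels compact). [cite: HarishChandra1999, §19 p. 84] -/
theorem isCompact_centralizer_inf_comap_congruenceGL [T2Space G] (hU : IsClosed (U : Set (GL (Fin n) F))) (γ : G) (δ : ValueGroupWithZero F) :
    IsCompact ((Subgroup.centralizer ({γ} : Set G) ⊓ (congruenceGL n δ).comap (U.subtype.comp e.toMulEquiv.toMonoidHom) : Subgroup G) : Set G) := by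
  rw [Subgroup.coe_inf]
  exact (isCompact_comap_congruenceGL e hU δ).inter_left (isClosed_centralizer_singleton γ)

/-- **`γ T₁` IS SMALL FOR DEEP `T₁`**: for every `W ∈ 𝓝 γ` (e.g. the regular set, ★ p855012 `isOpen_setOf_isRegularElt_cmDatum_local_all`) some `m` has `γ t ∈ W` for all
`t ∈ Z(γ) ⊓ K_m` (indeed for all `t ∈ K_m`). [cite: HarishChandra1999, §19 p. 84] -/
theorem exists_forall_mul_mem_of_mem_nhds (hϖ0 : ϖ ≠ 0) (hϖ1 : valuation F ϖ < 1) (γ : G) {W : Set G} (hW : W ∈ 𝓝 γ) :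
    ∃ m : ℕ, ∀ t ∈ (congruenceGL n (valuation F ϖ ^ m)).comap (U.subtype.comp e.toMulEquiv.toMonoidHom), γ * t ∈ W := by
  have h1 : (fun t : G => γ * t) ⁻¹' W ∈ 𝓝 (1 : G) := (continuous_const_mul γ).continuousAt.preimage_mem_nhds (by rwa [mul_one])
  obtain ⟨m, hm⟩ := exists_comap_congruenceGL_pow_subset e hϖ0 hϖ1 h1
  exact ⟨m, fun t ht => hm ht⟩

omit [IsTopologicalGroup G] in
/-- **UNIFORM HEIGHT ON THE SLICE SET `𝒰`** (the line lead's «`h` bounded» clause, K2 bus 2026-09-03T23:30:48Z): for `S ⊆ G` compact and `K₁, K₀` inside the integral level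
`e⁻¹(U ∩ GL_n(𝒪))`, some `h` bounds the entries of the matrix of `e y` and of its inverse by `(|ϖ|^h)⁻¹` for EVERY `y ∈ 𝒰 = (K₁ S K₁⁻¹) K₀` (§3 height of `S` + §2 of part 1:
integral factors do not raise the height). [cite: HarishChandra1999, §19 pp. 84–86] -/
theorem exists_height_conjSlice_mul (hϖ0 : ϖ ≠ 0) (hϖ1 : valuation F ϖ < 1) {S : Set G} (hS : IsCompact S) {K₁ K₀ : Subgroup G}
    (hK₁ : K₁ ≤ (glInt n F).comap (U.subtype.comp e.toMulEquiv.toMonoidHom)) (hK₀ : K₀ ≤ (glInt n F).comap (U.subtype.comp e.toMulEquiv.toMonoidHom)) :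
    ∃ h : ℕ, ∀ y ∈ (fun p : G × G => p.1 * p.2 * p.1⁻¹) '' ((K₁ : Set G) ×ˢ S) * (K₀ : Set G),
      ValBound (valuation F ϖ ^ h)⁻¹ (((e y : U) : GL (Fin n) F) : Matrix (Fin n) (Fin n) F) ∧
        ValBound (valuation F ϖ ^ h)⁻¹ ((((e y : U) : GL (Fin n) F)⁻¹ : GL (Fin n) F) : Matrix (Fin n) (Fin n) F) := by
  obtain ⟨h, hh⟩ := exists_height_of_isCompact_transport e hϖ0 hϖ1 hS
  refine ⟨h, fun y hy => ?_⟩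
  obtain ⟨k, hk, s, hs, k₀, hk₀, rfl⟩ := exists_eq_conj_mul_of_mem_conjSlice_mul hy
  obtain ⟨hs₁, hs₂⟩ := hh s hs
  have key := valBound_conj_mul_of_mem_glInt (hK₁ hk) (hK₀ hk₀) hs₁ hs₂
  simp only [map_mul, map_inv, Subgroup.coe_mul, Subgroup.coe_inv]
  exact key

end SliceTransport

/-! ## §5 The CM frame: `G = U_N(H)(L⁺_v) = (cmDatum L N H).Local v` at a non-split place, one-place model `e = localNonsplitEquiv` -/

section CMFrame

variable (L : Type) [Field L] [NumberField L] [IsCMField L] (N : ℕ) (H : Matrix (Fin N) (Fin N) L)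
  {v : HeightOneSpectrum (𝓞 ↥(maximalRealSubfield L))} (w : PlacesOver L v) (hw : IsCMField.complexConj L • w.1 = w.1)

/-- **`U_w = U(σ_w, H_w)(L_w)` IS CLOSED IN `GL_N(L_w)`** (`σ_w = galAdicCompletionMap` is continuous, ★ `continuous_galAdicCompletionMap`; ★ `isClosed_unitaryGroupOfForm`).
[cite: PlatonovRapinchuk1994, §3.3] -/
theorem isClosed_unitaryGroupOfForm_placeForm :
    IsClosed ((unitaryGroupOfForm (galAdicCompletionMap (L := L) (IsCMField.complexConj L) hw) (placeForm H w.1) :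
      Subgroup (GL (Fin N) (w.1.adicCompletion L))) : Set (GL (Fin N) (w.1.adicCompletion L))) := by
  haveI : T2Space (w.1.adicCompletion L) := inferInstance
  exact isClosed_unitaryGroupOfForm (continuous_galAdicCompletionMap L (IsCMField.complexConj L) hw) (placeForm H w.1)

/-- **THE CM LEVELS ARE COMPACT OPEN SUBGROUPS OF `(cmDatum L N H).Local v`** (`γ ≠ 0`): `K_γ := e⁻¹(U_w ∩ congruenceGL N γ)` along the one-place model
`e = localNonsplitEquiv` (a topological-group isomorphism onto the closed `U_w`). [cite: PlatonovRapinchuk1994, §5.1] [cite: BernsteinZelevinsky1976, §1.1] -/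
theorem isCompact_isOpen_cmLevel {γ : ValueGroupWithZero (w.1.adicCompletion L)} (hγ : γ ≠ 0) :
    IsCompact (((congruenceGL N γ).comap
        ((unitaryGroupOfForm (galAdicCompletionMap (L := L) (IsCMField.complexConj L) hw) (placeForm H w.1)).subtype.comp
          (localNonsplitEquiv (IsCMField.complexConj L) H (IsCMField.complexConj_ne_one L) w hw).toMulEquiv.toMonoidHom) :
        Subgroup ((cmDatum L N H).Local v)) : Set ((cmDatum L N H).Local v)) ∧
      IsOpen (((congruenceGL N γ).comap
        ((unitaryGroupOfForm (galAdicCompletionMap (L := L) (IsCMField.complexConj L) hw) (placeForm H w.1)).subtype.comp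
          (localNonsplitEquiv (IsCMField.complexConj L) H (IsCMField.complexConj_ne_one L) w hw).toMulEquiv.toMonoidHom) :
        Subgroup ((cmDatum L N H).Local v)) : Set ((cmDatum L N H).Local v)) :=
  ⟨isCompact_comap_congruenceGL _ (isClosed_unitaryGroupOfForm_placeForm L N H w hw) γ, isOpen_comap_congruenceGL _ hγ⟩

/-- **THE CM LEVELS ARE A NEIGHBOURHOOD BASIS OF `1`** in `(cmDatum L N H).Local v`. [cite: BernsteinZelevinsky1976, §1.1] [cite: PlatonovRapinchuk1994, §5.1] -/
theorem exists_cmLevel_subset {O : Set ((cmDatum L N H).Local v)} (hO : O ∈ 𝓝 (1 : (cmDatum L N H).Local v)) :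
    ∃ γ : (ValueGroupWithZero (w.1.adicCompletion L))ˣ, (((congruenceGL N (γ : ValueGroupWithZero (w.1.adicCompletion L))).comap
        ((unitaryGroupOfForm (galAdicCompletionMap (L := L) (IsCMField.complexConj L) hw) (placeForm H w.1)).subtype.comp
          (localNonsplitEquiv (IsCMField.complexConj L) H (IsCMField.complexConj_ne_one L) w hw).toMulEquiv.toMonoidHom) :
        Subgroup ((cmDatum L N H).Local v)) : Set ((cmDatum L N H).Local v)) ⊆ O :=
  exists_comap_congruenceGL_subset _ hO

/-- **THE CM LEVELS ARE NORMALISED BY THE CM INTEGRAL LEVEL** `e⁻¹(U_w ∩ GL_N(𝒪_w))` (= ★ `cmLocalIntegralLevel`, ★ `mem_localIntegralLevel_iff_of_smul_eq`), in the consumer's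
bytes `∀ x ∈ K₁, K₀.map (MulAut.conj x).toMonoidHom = K₀`. [cite: BernsteinZelevinsky1976, §3] [cite: PlatonovRapinchuk1994, §5.1] -/
theorem forall_map_conj_cmLevel_of_mem_glInt (γ : ValueGroupWithZero (w.1.adicCompletion L)) :
    ∀ x ∈ (glInt N (w.1.adicCompletion L)).comap
        ((unitaryGroupOfForm (galAdicCompletionMap (L := L) (IsCMField.complexConj L) hw) (placeForm H w.1)).subtype.comp
          (localNonsplitEquiv (IsCMField.complexConj L) H (IsCMField.complexConj_ne_one L) w hw).toMulEquiv.toMonoidHom),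
      ((congruenceGL N γ).comap
        ((unitaryGroupOfForm (galAdicCompletionMap (L := L) (IsCMField.complexConj L) hw) (placeForm H w.1)).subtype.comp
          (localNonsplitEquiv (IsCMField.complexConj L) H (IsCMField.complexConj_ne_one L) w hw).toMulEquiv.toMonoidHom)).map (MulAut.conj x).toMonoidHom =
      (congruenceGL N γ).comap
        ((unitaryGroupOfForm (galAdicCompletionMap (L := L) (IsCMField.complexConj L) hw) (placeForm H w.1)).subtype.comp
          (localNonsplitEquiv (IsCMField.complexConj L) H (IsCMField.complexConj_ne_one L) w hw).toMulEquiv.toMonoidHom) :=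
  forall_map_conj_comap_congruenceGL_of_mem_glInt _ γ

/-- **MEMBERSHIP IS READ ON THE `w`-EVALUATED MATRIX** (★ `coe_localNonsplitEquiv_apply` is `rfl`): `g ∈ K_γ` iff the unit of `GL_N(L_w)` whose matrix is the entrywise
evaluation at `w` of the matrix of `g ∈ GL_N(L ⊗ L⁺_v)` — i.e. `e g` — lies in `congruenceGL N γ`. [cite: PlatonovRapinchuk1994, §5.1] -/
theorem mem_cmLevel_iff (γ : ValueGroupWithZero (w.1.adicCompletion L)) (g : (cmDatum L N H).Local v) :
    g ∈ (congruenceGL N γ).comap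
        ((unitaryGroupOfForm (galAdicCompletionMap (L := L) (IsCMField.complexConj L) hw) (placeForm H w.1)).subtype.comp
          (localNonsplitEquiv (IsCMField.complexConj L) H (IsCMField.complexConj_ne_one L) w hw).toMulEquiv.toMonoidHom) ↔
      ((localNonsplitEquiv (IsCMField.complexConj L) H (IsCMField.complexConj_ne_one L) w hw g :
          ↥(unitaryGroupOfForm (galAdicCompletionMap (L := L) (IsCMField.complexConj L) hw) (placeForm H w.1))) : GL (Fin N) (w.1.adicCompletion L)) ∈
        congruenceGL N γ :=
  Iff.rfl

/-- The `w`-evaluated matrix of `g`, literally: the matrix of `e g` is `(↑g).map (eval at w)` (★ `coe_localNonsplitEquiv_apply`). [cite: PlatonovRapinchuk1994, §5.1] -/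
theorem coe_localNonsplitEquiv_eq_map (g : (cmDatum L N H).Local v) :
    (((localNonsplitEquiv (IsCMField.complexConj L) H (IsCMField.complexConj_ne_one L) w hw g :
        ↥(unitaryGroupOfForm (galAdicCompletionMap (L := L) (IsCMField.complexConj L) hw) (placeForm H w.1))) : GL (Fin N) (w.1.adicCompletion L)) :
          Matrix (Fin N) (Fin N) (w.1.adicCompletion L)) =
      ((g.val : GL (Fin N) (LocalRing L v)) : Matrix (Fin N) (Fin N) (LocalRing L v)).map
        (Pi.evalRingHom (fun w' : PlacesOver L v => w'.1.adicCompletion L) w) :=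
  rfl

end CMFrame

end Summit.HodgeConjecture.HodgeConjecture.Cruxes.H413.K2E3UnitaryCongruenceFrame

end
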